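import Mathlib.Analysis.MeanInequalities
import Mathlib.Analysis.MeanInequalitiesPow
import Literature.Barriers.MatrixMultiplication.YoungSubgroupBarrierProofs
import HarnessLib

/-!
# The Young-subgroup barrier extends to simultaneous (STPP) constructions

Topic `Literature/Barriers/MatrixMultiplication`; companion of `YoungSubgroupBarrier.lean`
(Blasiak–Church–Cohn–Grochow–Umans 2017, arXiv:1712.02302, Prop. 2.4 and Thm. 4.2) written during
the D-0021 barrier audit of 2026-08-16.  The catalogue entry lists "STPP constructions" among the
things NOT covered by the barrier (scope caveat (a)).  This file records, with proofs, that the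
conjugacy-class criterion of Prop. 2.4 has a verbatim analogue for FAMILIES of triples with the
simultaneous triple product property (Cohn–Kleinberg–Szegedy–Umans 2005, Def. 5.1, the tree's
`SimultaneousTPP`), for every exponent `w ≥ 2` — the only range that carries information about
`ω ∈ [2, 3]` — and hence that STPP families in `Sₙ` all of whose member sets are cosets of Young
subgroups prove nothing about `ω` either (for `n` large), exactly like single Young triples.

* `stpp_sum_card_mul_card_le_bc`, `stpp_sum_card_mul_card_le_ca` — the two remaining packing
  bounds `∑ᵢ |Bᵢ||Cᵢ| ≤ |G|`, `∑ᵢ |Cᵢ||Aᵢ| ≤ |G|` of Blasiak–Church–Cohn–Grochow–Naslund–Sawin–Umans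
  2017, §2 (the tree has `SimultaneousTPP.sum_card_mul_card_le`, the `AB` bound), valid for the
  two-clause CKSU definition in ANY finite group (non-emptiness of the third family is needed, as
  for the `AB` bound);
* `stpp_sum_rpow_two_thirds_le` — consequently `∑ᵢ (|Aᵢ||Bᵢ||Cᵢ|)^{2/3} ≤ |G|` (AM–GM);
* `BCCGU2017_prop24_stpp` — **Prop. 2.4 for STPP families**: if every member triple satisfies
  `k(G) · (|Aᵢ||Bᵢ||Cᵢ|)^{2/3} ≤ |G|` (`k(G)` = number of conjugacy classes), then
  `∑ᵢ (|Aᵢ||Bᵢ||Cᵢ|)^{w/3} ≤ ∑_χ χ(1)^w` for EVERY `w ≥ 2`, so the CKSU inequality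
  `∑ᵢ (|Aᵢ||Bᵢ||Cᵢ|)^{ω/3} ≤ ∑_χ χ(1)^ω` (CKSU 2005, Thm. 5.5) holds for all `ω ∈ [2,3]` and proves
  nothing.  Proof: `∑ᵢ Pᵢ^{w/3} ≤ (maxᵢ Pᵢ^{2/3})^{(w−2)/2} ∑ᵢ Pᵢ^{2/3} ≤ (|G|/k)^{(w−2)/2} |G|`, while
  the power mean over the `k' ≤ k` irreducible characters and `∑ χ(1)² = |G|` give
  `∑_χ χ(1)^w ≥ k' (|G|/k')^{w/2} ≥ |G| (|G|/k)^{(w−2)/2}`;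
* `tripleProductProperty_image_mul_right_iff` — the TPP is invariant under right translation
  of each set (the right quotient sets `Q(S) = SS⁻¹` do not change; Cohn–Umans 2003, §2);
* `young_stpp_no_nontrivial_bound` / `young_stpp_no_nontrivial_bound_holds` — the STPP form of
  `young_no_nontrivial_bound`: with the constants of Thm. 4.2, for every `n ≥ 2` with at most
  `e^{cn − d√n log n}` conjugacy classes in `Sₙ`, every STPP family whose members are right cosets
  `Y(αᵢ)aᵢ, Y(βᵢ)bᵢ, Y(γᵢ)cᵢ` of Young subgroups satisfies the CKSU inequality for all `w ≥ 2`.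
  (Every two-sided translate `x·Y(f)·y` of a Young subgroup is such a right coset:
  `x Y(f) y = Y(f ∘ x⁻¹) · (xy)`, so this is the general "Young-type member" case.)

What remains open in `Sₙ` is therefore exactly what the paper says (§5): triples — single or
simultaneous — with a member set that is not a coset of a Young subgroup (other subgroups, or
genuine subsets), of size `n!^{1/2}/e^{O(√n)}`.

## References

* J. Blasiak, T. Church, H. Cohn, J. A. Grochow, C. Umans, *Which groups are amenable to proving
  exponent two for matrix multiplication?*, arXiv:1712.02302 (2017), Prop. 2.4 (p. 4 of the held
  text), Thm. 4.2 and §5 (`BlasiakChurchCohnGrochowUmans2017`).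
* H. Cohn, R. Kleinberg, B. Szegedy, C. Umans, *Group-theoretic algorithms for matrix
  multiplication*, FOCS 2005, arXiv:math/0511460, Def. 5.1 and Thm. 5.5
  (`CohnKleinbergSzegedyUmans2005`).
* J. Blasiak, T. Church, H. Cohn, J. A. Grochow, E. Naslund, W. F. Sawin, C. Umans, *On cap sets and
  the group-theoretic approach to matrix multiplication*, Discrete Analysis 2017:3, §2, the packing
  bounds (`BlasiakChurchCohnGrochowNaslundSawinUmans2017`).
-/

noncomputable section

open Finset
open scoped BigOperators

namespace Literature.Barriers.MatrixMultiplication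

open Literature.RepresentationTheory.FiniteGroups Literature.Combinatorics.Additive

/-! ### The two remaining STPP packing bounds -/

section Packing

variable {G : Type*} [Group G] [Fintype G] [DecidableEq G] {ι : Type*} [Fintype ι]
  {A B C : ι → Finset G}

/-- **Packing bound `∑ᵢ |Bᵢ| |Cᵢ| ≤ |G|`** for an STPP family (CKSU 2005, Def. 5.1) with all `Aᵢ`
non-empty: the map `(i, b, c) ↦ b⁻¹c` on `⨆ᵢ Bᵢ × Cᵢ` is injective (clause (ii) with indices
`(j, j, i)` and `a = a' ∈ Aⱼ`, then clause (i)).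
[cite: BlasiakChurchCohnGrochowNaslundSawinUmans2017, §2] -/
theorem stpp_sum_card_mul_card_le_bc (h : SimultaneousTPP A B C) (hA : ∀ i, (A i).Nonempty) :
    ∑ i, (B i).card * (C i).card ≤ Fintype.card G := by
  classical
  set D : Finset (Σ _ : ι, G × G) := Finset.univ.sigma fun i => B i ×ˢ C i with hD
  have hinj : Set.InjOn (fun x : (Σ _ : ι, G × G) => x.2.1⁻¹ * x.2.2) ↑D := by
    rintro ⟨i, b, c⟩ hx ⟨j, b', c'⟩ hy (he : b⁻¹ * c = b'⁻¹ * c')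
    simp only [hD, Finset.coe_sigma, Set.mem_sigma_iff, Finset.coe_univ, Set.mem_univ, true_and,
      Finset.coe_product, Set.mem_prod, Finset.mem_coe] at hx hy
    obtain ⟨a, ha⟩ := hA j
    have key : a * a⁻¹ * b' * b⁻¹ * c * c'⁻¹ = 1 := by
      calc a * a⁻¹ * b' * b⁻¹ * c * c'⁻¹ = b' * (b⁻¹ * c) * c'⁻¹ := by group
        _ = b' * (b'⁻¹ * c') * c'⁻¹ := by rw [he]
        _ = 1 := by group
    obtain ⟨-, hji⟩ := h.2 j j i a ha a ha b' hy.1 b hx.1 c hx.2 c' hy.2 key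
    subst hji
    have key' : a * a⁻¹ * (b' * b⁻¹) * (c * c'⁻¹) = 1 := by
      simpa only [mul_assoc] using key
    obtain ⟨-, h2, h3⟩ := h.1 _ a ha a ha b' hy.1 b hx.1 c hx.2 c' hy.2 key'
    subst h2 h3
    rfl
  calc ∑ i, (B i).card * (C i).card = D.card := by
        rw [hD, Finset.card_sigma]; simp only [Finset.card_product]
    _ = (D.image fun x : (Σ _ : ι, G × G) => x.2.1⁻¹ * x.2.2).card :=
        (Finset.card_image_of_injOn hinj).symm
    _ ≤ Fintype.card G := Finset.card_le_univ _

/-- **Packing bound `∑ᵢ |Cᵢ| |Aᵢ| ≤ |G|`** for an STPP family (CKSU 2005, Def. 5.1) with all `Bᵢ`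
non-empty: the map `(i, c, a) ↦ c⁻¹a` on `⨆ᵢ Cᵢ × Aᵢ` is injective (clause (ii) with indices
`(i, j, j)` and `b = b' ∈ Bⱼ`, then clause (i)).
[cite: BlasiakChurchCohnGrochowNaslundSawinUmans2017, §2] -/
theorem stpp_sum_card_mul_card_le_ca (h : SimultaneousTPP A B C) (hB : ∀ i, (B i).Nonempty) :
    ∑ i, (C i).card * (A i).card ≤ Fintype.card G := by
  classical
  set D : Finset (Σ _ : ι, G × G) := Finset.univ.sigma fun i => C i ×ˢ A i with hD
  have hinj : Set.InjOn (fun x : (Σ _ : ι, G × G) => x.2.1⁻¹ * x.2.2) ↑D := by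
    rintro ⟨i, c, a⟩ hx ⟨j, c', a'⟩ hy (he : c⁻¹ * a = c'⁻¹ * a')
    simp only [hD, Finset.coe_sigma, Set.mem_sigma_iff, Finset.coe_univ, Set.mem_univ, true_and,
      Finset.coe_product, Set.mem_prod, Finset.mem_coe] at hx hy
    obtain ⟨b, hb⟩ := hB j
    have key : a * a'⁻¹ * b * b⁻¹ * c' * c⁻¹ = 1 := by
      calc a * a'⁻¹ * b * b⁻¹ * c' * c⁻¹ = c * (c⁻¹ * a) * a'⁻¹ * c' * c⁻¹ := by group
        _ = c * (c'⁻¹ * a') * a'⁻¹ * c' * c⁻¹ := by rw [he]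
        _ = 1 := by group
    obtain ⟨hij, -⟩ := h.2 i j j a hx.2 a' hy.2 b hb b hb c' hy.1 c hx.1 key
    subst hij
    have key' : a * a'⁻¹ * (b * b⁻¹) * (c' * c⁻¹) = 1 := by
      simpa only [mul_assoc] using key
    obtain ⟨h1, -, h3⟩ := h.1 _ a hx.2 a' hy.2 b hb b hb c' hy.1 c hx.1 key'
    subst h1 h3
    rfl
  calc ∑ i, (C i).card * (A i).card = D.card := by
        rw [hD, Finset.card_sigma]; simp only [Finset.card_product]
    _ = (D.image fun x : (Σ _ : ι, G × G) => x.2.1⁻¹ * x.2.2).card :=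
        (Finset.card_image_of_injOn hinj).symm
    _ ≤ Fintype.card G := Finset.card_le_univ _

/-- AM–GM in the form `(abc)^{2/3} = (ab·bc·ca)^{1/3} ≤ (ab + bc + ca)/3` for `a, b, c ≥ 0`.
[folklore] -/
theorem rpow_two_thirds_le_third_sum {a b c : ℝ} (ha : 0 ≤ a) (hb : 0 ≤ b) (hc : 0 ≤ c) :
    (a * b * c) ^ (2 / 3 : ℝ) ≤ (a * b + b * c + c * a) / 3 := by
  have h := Real.geom_mean_le_arith_mean3_weighted (w₁ := 1 / 3) (w₂ := 1 / 3) (w₃ := 1 / 3)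
    (p₁ := a * b) (p₂ := b * c) (p₃ := c * a) (by norm_num) (by norm_num) (by norm_num)
    (mul_nonneg ha hb) (mul_nonneg hb hc) (mul_nonneg hc ha) (by norm_num)
  have e : (a * b) ^ (1 / 3 : ℝ) * (b * c) ^ (1 / 3 : ℝ) * (c * a) ^ (1 / 3 : ℝ) =
      (a * b * c) ^ (2 / 3 : ℝ) := by
    rw [← Real.mul_rpow (mul_nonneg ha hb) (mul_nonneg hb hc),
      ← Real.mul_rpow (mul_nonneg (mul_nonneg ha hb) (mul_nonneg hb hc)) (mul_nonneg hc ha)]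
    have h2 : a * b * (b * c) * (c * a) = (a * b * c) ^ (2 : ℕ) := by ring
    rw [h2, ← Real.rpow_natCast, ← Real.rpow_mul (mul_nonneg (mul_nonneg ha hb) hc)]
    norm_num
  rw [e] at h
  linarith

/-- **`∑ᵢ (|Aᵢ||Bᵢ||Cᵢ|)^{2/3} ≤ |G|`** for an STPP family of non-empty sets in a finite group:
AM–GM and the three packing bounds `∑|Aᵢ||Bᵢ|, ∑|Bᵢ||Cᵢ|, ∑|Cᵢ||Aᵢ| ≤ |G|`.  (For comparison, an
STPP family proving `ω = 2` through CKSU Thm. 5.5 must have `∑ᵢ (|Aᵢ||Bᵢ||Cᵢ|)^{2/3} ≥ |G|^{1−o(1)}`.)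
[cite: BlasiakChurchCohnGrochowNaslundSawinUmans2017, §2] -/
theorem stpp_sum_rpow_two_thirds_le (h : SimultaneousTPP A B C) (hA : ∀ i, (A i).Nonempty)
    (hB : ∀ i, (B i).Nonempty) (hC : ∀ i, (C i).Nonempty) :
    ∑ i, (((A i).card * (B i).card * (C i).card : ℕ) : ℝ) ^ (2 / 3 : ℝ) ≤ Fintype.card G := by
  have hab : ((∑ i, (A i).card * (B i).card : ℕ) : ℝ) ≤ Fintype.card G := by
    exact_mod_cast h.sum_card_mul_card_le hC
  have hbc : ((∑ i, (B i).card * (C i).card : ℕ) : ℝ) ≤ Fintype.card G := by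
    exact_mod_cast stpp_sum_card_mul_card_le_bc h hA
  have hca : ((∑ i, (C i).card * (A i).card : ℕ) : ℝ) ≤ Fintype.card G := by
    exact_mod_cast stpp_sum_card_mul_card_le_ca h hB
  push_cast at hab hbc hca
  calc ∑ i, (((A i).card * (B i).card * (C i).card : ℕ) : ℝ) ^ (2 / 3 : ℝ)
      ≤ ∑ i, (((A i).card : ℝ) * (B i).card + ((B i).card : ℝ) * (C i).card +
          ((C i).card : ℝ) * (A i).card) / 3 := by
        refine Finset.sum_le_sum fun i _ => ?_
        push_cast
        exact rpow_two_thirds_le_third_sum (Nat.cast_nonneg _) (Nat.cast_nonneg _)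
          (Nat.cast_nonneg _)
    _ = ((∑ i, ((A i).card : ℝ) * (B i).card) + (∑ i, ((B i).card : ℝ) * (C i).card) +
          ∑ i, ((C i).card : ℝ) * (A i).card) / 3 := by
        rw [← Finset.sum_div, Finset.sum_add_distrib, Finset.sum_add_distrib]
    _ ≤ ((Fintype.card G : ℝ) + Fintype.card G + Fintype.card G) / 3 := by
        linarith [hab, hbc, hca]
    _ = Fintype.card G := by ring

end Packing

/-! ### Prop. 2.4 for STPP families -/

section Prop24STPP

/-- **The conjugacy-class criterion for STPP families** (the simultaneous form of BCCGU 2017,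
Prop. 2.4; not in print in this form).  Let `(Aᵢ, Bᵢ, Cᵢ)ᵢ` be an STPP family (CKSU 2005,
Def. 5.1) of non-empty subsets of a finite group `G` with `k` conjugacy classes, and suppose every
member triple satisfies the hypothesis of Prop. 2.4, `k · (|Aᵢ||Bᵢ||Cᵢ|)^{2/3} ≤ |G|`.  Then
`∑ᵢ (|Aᵢ||Bᵢ||Cᵢ|)^{w/3} ≤ ∑_χ χ(1)^w` for every real `w ≥ 2`; in particular the CKSU inequality
`∑ᵢ (|Aᵢ||Bᵢ||Cᵢ|)^{ω/3} ≤ ∑_χ χ(1)^ω` (CKSU 2005, Thm. 5.5) is satisfied by every `ω ∈ [2, 3]` and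
the family proves nothing about `ω`.  Proof: with `Pᵢ = |Aᵢ||Bᵢ||Cᵢ|` and `K = |G|/k`,
`∑ᵢ Pᵢ^{w/3} = ∑ᵢ (Pᵢ^{2/3})^{(w−2)/2} Pᵢ^{2/3} ≤ K^{(w−2)/2} ∑ᵢ Pᵢ^{2/3} ≤ K^{(w−2)/2} |G|`
(`stpp_sum_rpow_two_thirds_le`), while for the `k' ≤ k` irreducible characters the power-mean
inequality and `∑_χ χ(1)² = |G|` give `∑_χ χ(1)^w ≥ k'(|G|/k')^{w/2} = |G| (|G|/k')^{(w−2)/2}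
≥ |G| K^{(w−2)/2}`.  (For `w < 2` the conclusion can fail — many tiny triples — but `ω ≥ 2`.)
[cite: BlasiakChurchCohnGrochowUmans2017, Prop. 2.4] [cite: CohnKleinbergSzegedyUmans2005, Thm. 5.5] -/
theorem BCCGU2017_prop24_stpp (G : Type) [Group G] [Fintype G] [DecidableEq G] {ι : Type*}
    [Fintype ι] (A B C : ι → Finset G) (h : SimultaneousTPP A B C)
    (hA : ∀ i, (A i).Nonempty) (hB : ∀ i, (B i).Nonempty) (hC : ∀ i, (C i).Nonempty)
    (hk : ∀ i, (Nat.card (ConjClasses G) : ℝ) *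
        (((A i).card * (B i).card * (C i).card : ℕ) : ℝ) ^ (2 / 3 : ℝ) ≤ Fintype.card G) :
    ∀ w : ℝ, 2 ≤ w →
      ∑ i, (((A i).card * (B i).card * (C i).card : ℕ) : ℝ) ^ (w / 3) ≤ charDegreePowSum G w := by
  intro w hw
  classical
  set k : ℝ := (Nat.card (ConjClasses G) : ℝ) with hkdef
  set g : ℝ := (Fintype.card G : ℝ) with hgdef
  have hkpos : 0 < k := by rw [hkdef]; exact_mod_cast (Nat.card_pos (α := ConjClasses G))
  have hgpos : 0 < g := by rw [hgdef]; exact_mod_cast Fintype.card_pos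
  set K : ℝ := g / k with hKdef
  have hKpos : 0 < K := div_pos hgpos hkpos
  have hw2 : 0 ≤ (w - 2) / 2 := by linarith
  -- Step 1: each `Pᵢ^{2/3} ≤ K`
  have hPi : ∀ i, (((A i).card * (B i).card * (C i).card : ℕ) : ℝ) ^ (2 / 3 : ℝ) ≤ K := fun i => by
    rw [hKdef, le_div_iff₀ hkpos, mul_comm]; exact hk i
  -- Step 2: `Pᵢ^{w/3} ≤ K^{(w-2)/2} Pᵢ^{2/3}`
  have hterm : ∀ i, (((A i).card * (B i).card * (C i).card : ℕ) : ℝ) ^ (w / 3) ≤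
      K ^ ((w - 2) / 2) * (((A i).card * (B i).card * (C i).card : ℕ) : ℝ) ^ (2 / 3 : ℝ) := by
    intro i
    set P : ℝ := (((A i).card * (B i).card * (C i).card : ℕ) : ℝ) with hPdef
    have hP0 : 0 ≤ P := Nat.cast_nonneg _
    have hexp : 2 / 3 * ((w - 2) / 2) + 2 / 3 = w / 3 := by ring
    have e : P ^ (w / 3) = (P ^ (2 / 3 : ℝ)) ^ ((w - 2) / 2) * P ^ (2 / 3 : ℝ) := by
      rw [← Real.rpow_mul hP0, ← Real.rpow_add' hP0 (by rw [hexp]; positivity), hexp]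
    rw [e]
    exact mul_le_mul_of_nonneg_right (Real.rpow_le_rpow (by positivity) (hPi i) hw2)
      (by positivity)
  -- Step 3: `∑ Pᵢ^{w/3} ≤ K^{(w-2)/2} |G|`
  have hLHS : ∑ i, (((A i).card * (B i).card * (C i).card : ℕ) : ℝ) ^ (w / 3) ≤
      K ^ ((w - 2) / 2) * g :=
    calc ∑ i, (((A i).card * (B i).card * (C i).card : ℕ) : ℝ) ^ (w / 3)
        ≤ ∑ i, K ^ ((w - 2) / 2) * (((A i).card * (B i).card * (C i).card : ℕ) : ℝ) ^ (2 / 3 : ℝ) :=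
          Finset.sum_le_sum fun i _ => hterm i
      _ = K ^ ((w - 2) / 2) * ∑ i, (((A i).card * (B i).card * (C i).card : ℕ) : ℝ) ^ (2 / 3 : ℝ) := by
          rw [Finset.mul_sum]
      _ ≤ K ^ ((w - 2) / 2) * g :=
          mul_le_mul_of_nonneg_left (stpp_sum_rpow_two_thirds_le h hA hB hC) (by positivity)
  -- Step 4: `K^{(w-2)/2} |G| ≤ ∑_χ χ(1)^w` (power mean over the irreducible characters)
  have hRHS : K ^ ((w - 2) / 2) * g ≤ charDegreePowSum G w := by
    have hfin := irrChars_finite_holds G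
    set F := hfin.toFinset with hFdef
    have hre : ∀ χ ∈ F, χ 1 = (((χ 1).re : ℝ) : ℂ) ∧ 0 ≤ (χ 1).re := by
      intro χ hχ
      obtain ⟨d, _, hd⟩ := (hfin.mem_toFinset.mp hχ).exists_apply_one
      rw [hd]
      simp
    have hsq : ∑ χ ∈ F, (χ 1).re ^ 2 = g := by
      have h := sum_sq_charDegrees_holds G
      rw [finsum_mem_eq_finite_toFinset_sum _ hfin] at h
      have h' : ∑ χ ∈ F, χ 1 ^ 2 = ((∑ χ ∈ F, (χ 1).re ^ 2 : ℝ) : ℂ) := by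
        push_cast
        exact Finset.sum_congr rfl fun χ hχ => by rw [← (hre χ hχ).1]
      rw [h', Nat.card_eq_fintype_card] at h
      rw [hgdef]
      exact_mod_cast h
    have hFne : F.Nonempty := ⟨_, hfin.mem_toFinset.mpr character_trivial_mem_irrChars⟩
    have hcardF : (F.card : ℝ) ≤ k := by
      rw [hkdef]; exact_mod_cast card_irrChars_le_card_conjClasses
    have hFpos : (0 : ℝ) < F.card := by exact_mod_cast hFne.card_pos
    have hsumw : charDegreePowSum G w = ∑ χ ∈ F, (χ 1).re ^ w := by
      unfold charDegreePowSum
      rw [finsum_mem_eq_finite_toFinset_sum _ hfin]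
    have hd : ∀ χ ∈ F, ((χ 1).re ^ 2) ^ (w / 2) = (χ 1).re ^ w := fun χ hχ => by
      rw [← Real.rpow_natCast, ← Real.rpow_mul (hre χ hχ).2]
      congr 1
      push_cast
      ring
    -- the power mean inequality with uniform weights `1/|F|`, `zᵪ = χ(1)²`, exponent `w/2 ≥ 1`
    have hpm := Real.rpow_arith_mean_le_arith_mean_rpow F (fun _ => (1 : ℝ) / F.card)
      (fun χ => (χ 1).re ^ 2) (fun _ _ => by positivity)
      (by rw [Finset.sum_const, nsmul_eq_mul, mul_one_div_cancel hFpos.ne'])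
      (fun _ _ => sq_nonneg _) (by linarith : 1 ≤ w / 2)
    have hl : ∑ χ ∈ F, (1 : ℝ) / F.card * (χ 1).re ^ 2 = g / F.card := by
      rw [← Finset.mul_sum, hsq]; ring
    have hr : ∑ χ ∈ F, (1 : ℝ) / F.card * ((χ 1).re ^ 2) ^ (w / 2) =
        1 / F.card * charDegreePowSum G w := by
      rw [← Finset.mul_sum, hsumw]
      congr 1
      exact Finset.sum_congr rfl hd
    rw [hl, hr] at hpm
    -- `hpm : (g/|F|)^{w/2} ≤ (1/|F|) ∑ χ(1)^w`
    have h2 : (F.card : ℝ) * (g / F.card) ^ (w / 2) ≤ charDegreePowSum G w := by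
      have := mul_le_mul_of_nonneg_left hpm hFpos.le
      rwa [← mul_assoc, mul_one_div_cancel hFpos.ne', one_mul] at this
    have h3 : (F.card : ℝ) * (g / F.card) ^ (w / 2) = (g / F.card) ^ ((w - 2) / 2) * g := by
      have hgF : 0 < g / F.card := div_pos hgpos hFpos
      have hw' : w / 2 = (w - 2) / 2 + 1 := by ring
      rw [hw', Real.rpow_add hgF, Real.rpow_one]
      calc (F.card : ℝ) * ((g / F.card) ^ ((w - 2) / 2) * (g / F.card))
          = (g / F.card) ^ ((w - 2) / 2) * (g / F.card * F.card) := by ring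
        _ = (g / F.card) ^ ((w - 2) / 2) * g := by rw [div_mul_cancel₀ g hFpos.ne']
    have h4 : K ^ ((w - 2) / 2) ≤ (g / F.card) ^ ((w - 2) / 2) :=
      Real.rpow_le_rpow hKpos.le (div_le_div_of_nonneg_left hgpos.le hFpos hcardF) hw2
    calc K ^ ((w - 2) / 2) * g ≤ (g / F.card) ^ ((w - 2) / 2) * g :=
          mul_le_mul_of_nonneg_right h4 hgpos.le
      _ = F.card * (g / F.card) ^ (w / 2) := h3.symm
      _ ≤ charDegreePowSum G w := h2
  exact hLHS.trans hRHS

end Prop24STPP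

/-! ### Right-translation invariance of the triple product property -/

section Translate

/-- **The triple product property is invariant under right translation of each set** (Cohn–Umans
2003, §2: the condition only involves the right quotient sets `Q(S) = SS⁻¹`, and
`(sa)(s'a)⁻¹ = ss'⁻¹`).  In particular a triple of right cosets `H₁a, H₂b, H₃c` of subgroups has
the TPP iff `(H₁, H₂, H₃)` has it. [cite: CohnUmans2003, Def. 2.1] -/
theorem tripleProductProperty_image_mul_right_iff {G : Type*} [Group G] [DecidableEq G]
    (S T U : Finset G) (a b c : G) :
    TripleProductProperty (S.image (· * a)) (T.image (· * b)) (U.image (· * c)) ↔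
      TripleProductProperty S T U := by
  constructor
  · intro h s hs s' hs' t ht t' ht' u hu u' hu' he
    have e1 : s * a * (s' * a)⁻¹ = s * s'⁻¹ := by group
    have e2 : t * b * (t' * b)⁻¹ = t * t'⁻¹ := by group
    have e3 : u * c * (u' * c)⁻¹ = u * u'⁻¹ := by group
    have key := h (s * a) (Finset.mem_image_of_mem (· * a) hs) (s' * a)
      (Finset.mem_image_of_mem (· * a) hs') (t * b) (Finset.mem_image_of_mem (· * b) ht) (t' * b)
      (Finset.mem_image_of_mem (· * b) ht') (u * c) (Finset.mem_image_of_mem (· * c) hu) (u' * c)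
      (Finset.mem_image_of_mem (· * c) hu') (by rw [e1, e2, e3]; exact he)
    exact ⟨mul_right_cancel key.1, mul_right_cancel key.2.1, mul_right_cancel key.2.2⟩
  · intro h x hx x' hx' y hy y' hy' z hz z' hz' he
    obtain ⟨s, hs, rfl⟩ := Finset.mem_image.1 hx
    obtain ⟨s', hs', rfl⟩ := Finset.mem_image.1 hx'
    obtain ⟨t, ht, rfl⟩ := Finset.mem_image.1 hy
    obtain ⟨t', ht', rfl⟩ := Finset.mem_image.1 hy'
    obtain ⟨u, hu, rfl⟩ := Finset.mem_image.1 hz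
    obtain ⟨u', hu', rfl⟩ := Finset.mem_image.1 hz'
    have e1 : s * a * (s' * a)⁻¹ = s * s'⁻¹ := by group
    have e2 : t * b * (t' * b)⁻¹ = t * t'⁻¹ := by group
    have e3 : u * c * (u' * c)⁻¹ = u * u'⁻¹ := by group
    have he' : s * s'⁻¹ * (t * t'⁻¹) * (u * u'⁻¹) = 1 := by
      rw [← e1, ← e2, ← e3]; exact he
    obtain ⟨h1, h2, h3⟩ := h s hs s' hs' t ht t' ht' u hu u' hu' he'
    subst h1 h2 h3
    exact ⟨rfl, rfl, rfl⟩

end Translate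

/-! ### Consequence: STPP families of Young cosets in `Sₙ` prove nothing -/

section YoungSTPP

/-- **No non-trivial bound from STPP families of Young cosets (STPP form of
`young_no_nontrivial_bound`)**, from Thm. 4.2: with the constants `c, d` of Thm. 4.2, for every
`n ≥ 2` such that `Sₙ` has at most `e^{cn − d√n log n}` conjugacy classes, every family of triples
`(Y(αᵢ)aᵢ, Y(βᵢ)bᵢ, Y(γᵢ)cᵢ)ᵢ` of right cosets of Young subgroups with the simultaneous triple
product property satisfies `∑ᵢ (|Y(αᵢ)||Y(βᵢ)||Y(γᵢ)|)^{w/3} ≤ ∑_χ χ(1)^w` for ALL `w ≥ 2` — the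
CKSU inequality (Thm. 5.5) carries no information about `ω`.  Each member triple has the TPP, hence
(right-translation invariance) so does `(Y(αᵢ), Y(βᵢ), Y(γᵢ))`, whose pairwise intersections are
then trivial, so Thm. 4.2 gives `k(Sₙ)·Pᵢ^{2/3} ≤ n!` and `BCCGU2017_prop24_stpp` applies.  Since
`x·Y(f)·y = Y(f ∘ x⁻¹)·(xy)`, right cosets of Young subgroups are all two-sided translates.
[cite: BlasiakChurchCohnGrochowUmans2017, Thm. 4.2 and Prop. 2.4]
[cite: CohnKleinbergSzegedyUmans2005, Thm. 5.5] -/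
theorem young_stpp_no_nontrivial_bound (h42 : BCCGU2017_thm42) :
    ∃ c d : ℝ, 0 < c ∧ 0 < d ∧ ∀ n : ℕ, 2 ≤ n →
      (Nat.card (ConjClasses (Equiv.Perm (Fin n))) : ℝ) ≤
          Real.exp (c * n - d * Real.sqrt n * Real.log n) →
      ∀ {ι : Type} [Fintype ι] (f₁ f₂ f₃ : ι → (Fin n → ℕ)) (x y z : ι → Equiv.Perm (Fin n)),
        SimultaneousTPP
          (fun i => (Finset.univ.filter (· ∈ youngSubgroup (f₁ i))).image (· * x i))
          (fun i => (Finset.univ.filter (· ∈ youngSubgroup (f₂ i))).image (· * y i))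
          (fun i => (Finset.univ.filter (· ∈ youngSubgroup (f₃ i))).image (· * z i)) →
        ∀ w : ℝ, 2 ≤ w →
          ∑ i, ((((Finset.univ.filter (· ∈ youngSubgroup (f₁ i))).image (· * x i)).card *
              ((Finset.univ.filter (· ∈ youngSubgroup (f₂ i))).image (· * y i)).card *
              ((Finset.univ.filter (· ∈ youngSubgroup (f₃ i))).image (· * z i)).card : ℕ) : ℝ) ^
                (w / 3) ≤
            charDegreePowSum (Equiv.Perm (Fin n)) w := by
  obtain ⟨c, d, hc, hd, h⟩ := h42
  refine ⟨c, d, hc, hd, fun n hn hclass ι _ f₁ f₂ f₃ x y z hS w hw => ?_⟩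
  -- non-emptiness of the cosets (they contain `1 * g`)
  have hne : ∀ (f : Fin n → ℕ) (g : Equiv.Perm (Fin n)),
      ((Finset.univ.filter (· ∈ youngSubgroup f)).image (· * g)).Nonempty := fun f g =>
    Finset.Nonempty.image ⟨1, by simp⟩ _
  refine BCCGU2017_prop24_stpp (Equiv.Perm (Fin n)) _ _ _ hS (fun i => hne _ _) (fun i => hne _ _)
    (fun i => hne _ _) (fun i => ?_) w hw
  -- the member triple: TPP of the cosets ⇒ TPP of the Young subgroups ⇒ pairwise trivial meets
  have hT := (tripleProductProperty_image_mul_right_iff _ _ _ (x i) (y i) (z i)).1 (hS.1 i)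
  obtain ⟨h12, h23, h13⟩ := inf_eq_bot_of_tripleProductProperty _ _ _ hT
  have hbound := h n hn (f₁ i) (f₂ i) (f₃ i) h12 h23 h13
  -- cardinalities: `|Hg| = |H| = Nat.card H`, `|Sₙ| = n!`
  have hcardS : (Fintype.card (Equiv.Perm (Fin n)) : ℝ) = n.factorial := by
    rw [Fintype.card_perm, Fintype.card_fin]
  have himage : ∀ (H : Subgroup (Equiv.Perm (Fin n))) [DecidablePred (· ∈ H)]
      (g : Equiv.Perm (Fin n)),
      ((Finset.univ.filter (· ∈ H)).image (· * g)).card = Nat.card H := by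
    intro H _ g
    rw [Finset.card_image_of_injective _ (mul_left_injective g),
      Nat.card_eq_fintype_card (α := ↥H),
      Fintype.card_of_subtype (Finset.univ.filter (· ∈ H)) (fun x => by simp)]
  have hP : (((Finset.univ.filter (· ∈ youngSubgroup (f₁ i))).image (· * x i)).card *
      ((Finset.univ.filter (· ∈ youngSubgroup (f₂ i))).image (· * y i)).card *
      ((Finset.univ.filter (· ∈ youngSubgroup (f₃ i))).image (· * z i)).card : ℕ) =
      Nat.card (youngSubgroup (f₁ i)) * Nat.card (youngSubgroup (f₂ i)) *
        Nat.card (youngSubgroup (f₃ i)) := by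
    rw [himage, himage, himage]
  rw [hP, hcardS]
  set P : ℕ := Nat.card (youngSubgroup (f₁ i)) * Nat.card (youngSubgroup (f₂ i)) *
    Nat.card (youngSubgroup (f₃ i)) with hPdef
  have hP0 : (0 : ℝ) < (P : ℝ) ^ (2 / 3 : ℝ) := by
    have : 0 < P := by
      rw [hPdef]; exact Nat.mul_pos (Nat.mul_pos Nat.card_pos Nat.card_pos) Nat.card_pos
    exact Real.rpow_pos_of_pos (by exact_mod_cast this) _
  rw [le_div_iff₀ hP0] at hbound
  exact (mul_le_mul_of_nonneg_right hclass hP0.le).trans hbound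

/-- The STPP form of the barrier's conclusion, unconditional (Thm. 4.2 is the tree theorem
`BCCGU2017_thm42_holds`, constants `c = 1/5`, `d = 3e⁷`).
[cite: BlasiakChurchCohnGrochowUmans2017, Thm. 4.2 and Prop. 2.4] -/
theorem young_stpp_no_nontrivial_bound_holds :
    ∃ c d : ℝ, 0 < c ∧ 0 < d ∧ ∀ n : ℕ, 2 ≤ n →
      (Nat.card (ConjClasses (Equiv.Perm (Fin n))) : ℝ) ≤
          Real.exp (c * n - d * Real.sqrt n * Real.log n) →
      ∀ {ι : Type} [Fintype ι] (f₁ f₂ f₃ : ι → (Fin n → ℕ)) (x y z : ι → Equiv.Perm (Fin n)),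
        SimultaneousTPP
          (fun i => (Finset.univ.filter (· ∈ youngSubgroup (f₁ i))).image (· * x i))
          (fun i => (Finset.univ.filter (· ∈ youngSubgroup (f₂ i))).image (· * y i))
          (fun i => (Finset.univ.filter (· ∈ youngSubgroup (f₃ i))).image (· * z i)) →
        ∀ w : ℝ, 2 ≤ w →
          ∑ i, ((((Finset.univ.filter (· ∈ youngSubgroup (f₁ i))).image (· * x i)).card *
              ((Finset.univ.filter (· ∈ youngSubgroup (f₂ i))).image (· * y i)).card *
              ((Finset.univ.filter (· ∈ youngSubgroup (f₃ i))).image (· * z i)).card : ℕ) : ℝ) ^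
                (w / 3) ≤
            charDegreePowSum (Equiv.Perm (Fin n)) w :=
  young_stpp_no_nontrivial_bound BCCGU2017_thm42_holds

end YoungSTPP

end Literature.Barriers.MatrixMultiplication

end
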